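import Summits.FinalStateConjecture.FinalStateConjecture.Theorems.EIHFluxBalanceInertialRecessionStubEndgameToyCross

/-!
# Route EIHFluxBalance — crux `InertialRecession`, line `sublinear-is-free-clean-window-charges`:
# the N-body CLEAN-SCALE TOY, `p = 3/2` — the slow-group induction `Λ(n)`

Helper file for the crux `stmt-FinalStateConjecture-10166`
(`Summit.FinalStateConjecture.FinalStateConjecture.Theses.EIHFluxBalance.InertialRecession`), registered stub
`stub_pairwiseDichotomy` (lead reshape r7) of `Cruxes/InertialRecession/Lines/sublinear_is_free_clean_window_charges.lean`;
third file of the toy series (see `…ToyBasics` for the setting, `…ToyCross` for the split phase).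

`slowGroup_induction` (Lemma Λ): by induction on `d ≥ |G|`. A nonempty group `G` whose velocity spread at time `a₀ ≥ T` is
`≤ θ` (`θ` above the level-`d` threshold `24(N+d)θ_g·400^{d³+d}`), whose cross distances to outsiders have inverse `3/2`-powers
majorised on `[a₀,u]` by a continuous `φ ≥ 0` of budget `K∫φ ≤ m_min(10θ_g + (N−d)N²ε₀)`, keeps EVERY member velocity within
`12θ + 12dθ_g` of its initial value on `[a₀,u]`. Proof: until the first time `t₁` at which the spread reaches `10θ`, track the
mass-weighted mean velocity `V_G` (its increment is the cluster-momentum increment over `m_G`, bounded by budget + `ε₀`; the wobble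
`‖v_k − V_G‖` is at most the spread, `norm_sub_weightedMean_le'`); at `t₁` split `G` by the empty band of its velocity
configuration (`exists_gap_finset`, threshold `θ″ ≤ θ/40`, cross speeds `≥ 400θ″`, classes proper because some pair has speed `10θ`)
and apply `crossBootstrap` with the induction hypothesis.

References: D. Saari, Trans. AMS 156 (1971) 219–240; C. Marchal, D. Saari, J. Differential Equations 20 (1976) 150–186.
-/

noncomputable section

set_option linter.dupNamespace false

open Filter Topology Set MeasureTheory intervalIntegral
open scoped Topology BigOperators

namespace Summit.FinalStateConjecture.FinalStateConjecture.Theorems.SublinearIsFree.Toy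

open Literature.Geometry.Lorentzian
open Summit.FinalStateConjecture.FinalStateConjecture.Theorems.SublinearIsFree.Endgame

/-! ### Lemma Λ: slow groups under ballistic outsiders -/

set_option maxHeartbeats 800000 in
/-- **LEMMA Λ (slow-group induction) for the clean-scale toy, `p = 3/2`.** See the module docstring. The hypotheses before the
colon are the toy (`ξ̇ = v`, `v̇ = a`, clean-cluster balance), the lateness data (`T ≥ t₀ ∨ 1`, all distances `≥ A` after `T`),
the minimal mass `m_min`, the global minimal threshold `θ_g` and the error quantum `ε₀` with the two lateness inequalities
(ballistic budget at speed `θ_g`, time term); after the colon, the level `d`, the group, the interval, the level threshold, the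
initial spread, the outsider majorant and its budget. Conclusion: member drifts `≤ 12θ + 12dθ_g`. [folklore] -/
theorem slowGroup_induction {N n : ℕ} {m : Fin N → ℝ} {ξ v a : Fin N → ℝ → (Fin n → ℝ)}
    {t₀ K T A mmin θg ε₀ : ℝ}
    (hm : ∀ i, mmin ≤ m i) (hmmin : 0 < mmin) (hK : 0 ≤ K)
    (hξ : ∀ i t, HasDerivAt (ξ i) (v i t) t) (hv : ∀ i t, HasDerivAt (v i) (a i t) t)
    (hbal : ∀ (C : Finset (Fin N)) (t r : ℝ), t₀ ≤ t → 0 < r → r ≤ t → C.Nonempty →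
      (∀ i ∈ C, ∀ j ∉ C, r ≤ ‖ξ i t - ξ j t‖) → ‖∑ i ∈ C, m i • a i t‖ ≤ K * r ^ (-(3 / 2 : ℝ)))
    (hT : t₀ ≤ T) (hT1 : 1 ≤ T) (hA : 0 < A)
    (hfar : ∀ i j, i ≠ j → ∀ t, T ≤ t → A ≤ ‖ξ i t - ξ j t‖)
    (hθg : 0 < θg) (hε₀ : 0 ≤ ε₀) (hεθ : 100 * (N : ℝ) ^ 3 * ε₀ ≤ θg)
    (hE1 : K * (2 * √2 * (8 / (θg * √A))) ≤ mmin * ε₀)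
    (hE2 : K * (2 * (√T)⁻¹) ≤ mmin * ε₀) :
    ∀ (d : ℕ) (G : Finset (Fin N)), G.card ≤ d → G.Nonempty →
    ∀ (a₀ u θ : ℝ) (φ : ℝ → ℝ), T ≤ a₀ → a₀ ≤ u → 24 * (N + d) * θg * 400 ^ (d ^ 3 + d) ≤ θ →
    (∀ k ∈ G, ∀ l ∈ G, ‖v k a₀ - v l a₀‖ ≤ θ) →
    Continuous φ → (∀ s, 0 ≤ φ s) →
    (∀ s ∈ Icc a₀ u, ∀ i ∈ G, ∀ j ∉ G, (‖ξ i s - ξ j s‖ * √‖ξ i s - ξ j s‖)⁻¹ ≤ φ s) →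
    K * (∫ s in a₀..u, φ s) ≤ mmin * (10 * θg + (N - d) * (N ^ 2 * ε₀)) →
    ∀ t ∈ Icc a₀ u, ∀ k ∈ G, ‖v k t - v k a₀‖ ≤ 12 * θ + 12 * d * θg := by
  classical
  -- continuity of the velocities
  have hvc : ∀ i, Continuous (v i) := fun i ↦ continuous_iff_continuousAt.mpr fun t ↦ (hv i t).continuousAt
  have hmpos : ∀ i, 0 < m i := fun i ↦ hmmin.trans_le (hm i)
  have hT0 : 0 < T := one_pos.trans_le hT1
  intro d
  induction d with
  | zero =>
      intro G hG hGne
      exact absurd (Finset.card_pos.mpr hGne) (by omega)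
  | succ d IH =>
    intro G hGcard hGne a₀ u θ φ ha₀ hau hθ hslow hφc hφ0 hφ hbud t ht k hk
    -- make the base `400` opaque (keeps `rw`/`linarith` away from large numerals)
    generalize hQgen : (400 : ℝ) = Q at hθ
    have hQ1 : (1 : ℝ) ≤ Q := by rw [← hQgen]; norm_num
    have hQ0 : (0 : ℝ) < Q := by rw [← hQgen]; norm_num
    -- basic sizes
    have hN1 : (1 : ℝ) ≤ N := by
      have : 0 < N := Fin.pos (hGne.choose)
      exact_mod_cast this
    have hθpos : 0 < θ := by
      have : 0 < 24 * ((N : ℝ) + (d + 1 : ℕ)) * θg * Q ^ ((d + 1) ^ 3 + (d + 1)) := by positivity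
      linarith
    have hε₀θg : ε₀ ≤ θg / 100 := by
      have h1 : (N : ℝ) ^ 3 ≥ 1 := one_le_pow₀ hN1
      nlinarith
    have hNε : (N : ℝ) ^ 3 * ε₀ ≤ θg / 100 := by nlinarith
    have ha0 : 0 < a₀ := hT0.trans_le ha₀
    -- positivity of cross distances on `[T, ∞)`
    have hposG : ∀ s, T ≤ s → ∀ i ∈ G, ∀ j ∉ G, 0 < ‖ξ i s - ξ j s‖ := fun s hs i hi j hj ↦
      hA.trans_le (hfar i j (fun h ↦ hj (h ▸ hi)) s hs)
    -- the mass-weighted mean velocity of `G` and the PHASE-1 DRIFT BOUND at any time where the spread has stayed `≤ 10θ`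
    set mG : ℝ := ∑ i ∈ G, m i with hmG
    have hmGpos : 0 < mG := Finset.sum_pos (fun i _ ↦ hmpos i) hGne
    have hmGge : mmin ≤ mG := by
      obtain ⟨i₀, hi₀⟩ := hGne
      calc mmin ≤ m i₀ := hm i₀
        _ ≤ mG := Finset.single_le_sum (fun i _ ↦ (hmpos i).le) hi₀
    have hincr : ∀ s ∈ Icc a₀ u, ‖∑ i ∈ G, m i • v i s - ∑ i ∈ G, m i • v i a₀‖ ≤ mmin * (11 * θg) := by
      intro s hs
      have h1 := norm_clusterMomentum_sub_le hv hbal hK hGne (hT.trans ha₀) ha0 hφc hφ0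
        (fun σ hσ i hi j hj ↦ hposG σ (ha₀.trans hσ.1) i hi j hj) hφ s hs
      have h2 : ∫ σ in a₀..s, φ σ ≤ ∫ σ in a₀..u, φ σ :=
        intervalIntegral.integral_mono_interval le_rfl hs.1 hs.2 (Eventually.of_forall fun x ↦ hφ0 x)
          (hφc.intervalIntegrable _ _)
      have h3 : 2 * (√a₀)⁻¹ ≤ 2 * (√T)⁻¹ := by
        gcongr
      have h4 : K * ((∫ σ in a₀..s, φ σ) + 2 * (√a₀)⁻¹) ≤ mmin * (10 * θg + (N - (d + 1 : ℕ)) * (N ^ 2 * ε₀)) + mmin * ε₀ := by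
        have := mul_le_mul_of_nonneg_left h2 hK
        have := mul_le_mul_of_nonneg_left h3 hK
        nlinarith
      have h5 : (N - (d + 1 : ℕ) : ℝ) * (N ^ 2 * ε₀) ≤ N ^ 3 * ε₀ := by
        have : (N - (d + 1 : ℕ) : ℝ) ≤ N := by
          have : (0 : ℝ) ≤ (d + 1 : ℕ) := by positivity
          linarith
        have h0 : 0 ≤ (N : ℝ) ^ 2 * ε₀ := by positivity
        nlinarith
      calc ‖∑ i ∈ G, m i • v i s - ∑ i ∈ G, m i • v i a₀‖ ≤ K * ((∫ σ in a₀..s, φ σ) + 2 * (√a₀)⁻¹) := h1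
        _ ≤ mmin * (10 * θg + N ^ 3 * ε₀) + mmin * ε₀ := by nlinarith
        _ ≤ mmin * (11 * θg) := by nlinarith
    have phase1 : ∀ s ∈ Icc a₀ u, (∀ k ∈ G, ∀ l ∈ G, ‖v k s - v l s‖ ≤ 10 * θ) →
        ∀ k ∈ G, ‖v k s - v k a₀‖ ≤ 11 * θ + 11 * θg := by
      intro s hs hsp k hk
      set V : ℝ → (Fin n → ℝ) := fun σ ↦ mG⁻¹ • ∑ i ∈ G, m i • v i σ with hV
      have hw1 : ‖v k s - V s‖ ≤ 10 * θ :=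
        norm_sub_weightedMean_le' G m (fun i ↦ v i s) hk (fun i _ ↦ hmpos i) fun l hl ↦ hsp k hk l hl
      have hw0 : ‖v k a₀ - V a₀‖ ≤ θ :=
        norm_sub_weightedMean_le' G m (fun i ↦ v i a₀) hk (fun i _ ↦ hmpos i) fun l hl ↦ hslow k hk l hl
      have hVV : ‖V s - V a₀‖ ≤ 11 * θg := by
        have : V s - V a₀ = mG⁻¹ • (∑ i ∈ G, m i • v i s - ∑ i ∈ G, m i • v i a₀) := by
          simp only [hV, smul_sub]
        rw [this, norm_smul, norm_inv, Real.norm_eq_abs, abs_of_pos hmGpos]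
        rw [inv_mul_le_iff₀ hmGpos]
        calc ‖∑ i ∈ G, m i • v i s - ∑ i ∈ G, m i • v i a₀‖ ≤ mmin * (11 * θg) := hincr s hs
          _ ≤ mG * (11 * θg) := by nlinarith
      calc ‖v k s - v k a₀‖ = ‖(v k s - V s) + (V s - V a₀) - (v k a₀ - V a₀)‖ := by abel_nf
        _ ≤ ‖v k s - V s‖ + ‖V s - V a₀‖ + ‖v k a₀ - V a₀‖ := norm_sub_le_of_le (norm_add_le _ _) le_rfl
        _ ≤ 11 * θ + 11 * θg := by linarith
    -- the bad set and the splitting time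
    set BAD : Set ℝ := {s | s ∈ Icc a₀ u ∧ ∃ k ∈ G, ∃ l ∈ G, 10 * θ < ‖v k s - v l s‖} with hBAD
    by_cases hBADne : ¬ BAD.Nonempty
    · -- no splitting needed: phase 1 on the whole interval
      have hsp : ∀ s ∈ Icc a₀ u, ∀ k ∈ G, ∀ l ∈ G, ‖v k s - v l s‖ ≤ 10 * θ := by
        intro s hs k hk l hl
        by_contra h
        exact hBADne ⟨s, hs, k, hk, l, hl, not_le.mp h⟩
      have h1 := phase1 t ht (hsp t ht) k hk
      have hd0 : 0 ≤ (d : ℝ) * θg := by positivity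
      rw [Nat.cast_succ]
      linarith only [h1, hd0, hθpos, hθg]
    push Not at hBADne
    have hBADbdd : BddBelow BAD := ⟨a₀, fun s hs ↦ hs.1.1⟩
    set t₁ : ℝ := sInf BAD with ht₁
    have hat₁ : a₀ ≤ t₁ := le_csInf hBADne fun s hs ↦ hs.1.1
    have ht₁u : t₁ ≤ u := by
      obtain ⟨s, hs⟩ := hBADne
      exact (csInf_le hBADbdd hs).trans hs.1.2
    have hTt₁ : T ≤ t₁ := ha₀.trans hat₁
    -- before `t₁` and at `t₁` the spread is `≤ 10θ`
    have hsp_lt : ∀ s ∈ Ico a₀ t₁, ∀ k ∈ G, ∀ l ∈ G, ‖v k s - v l s‖ ≤ 10 * θ := by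
      intro s hs k hk l hl
      by_contra h
      have : t₁ ≤ s := csInf_le hBADbdd ⟨⟨hs.1, hs.2.le.trans ht₁u⟩, k, hk, l, hl, not_le.mp h⟩
      exact absurd this (not_le.mpr hs.2)
    have hsp_t₁ : ∀ k ∈ G, ∀ l ∈ G, ‖v k t₁ - v l t₁‖ ≤ 10 * θ := by
      intro k hk l hl
      rcases eq_or_lt_of_le hat₁ with h | h
      · rw [← h]; linarith [hslow k hk l hl]
      · have hc : Continuous fun s ↦ ‖v k s - v l s‖ := ((hvc k).sub (hvc l)).norm
        have htend : Tendsto (fun s ↦ ‖v k s - v l s‖) (𝓝[<] t₁) (𝓝 ‖v k t₁ - v l t₁‖) :=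
          hc.continuousAt.tendsto.mono_left nhdsWithin_le_nhds
        exact le_of_tendsto htend (mem_of_superset (Ico_mem_nhdsLT h) fun s hs ↦ hsp_lt s hs k hk l hl)
    have hsp_le : ∀ s ∈ Icc a₀ t₁, ∀ k ∈ G, ∀ l ∈ G, ‖v k s - v l s‖ ≤ 10 * θ := by
      intro s hs k hk l hl
      rcases eq_or_lt_of_le hs.2 with h | h
      · rw [h]; exact hsp_t₁ k hk l hl
      · exact hsp_lt s ⟨hs.1, h⟩ k hk l hl
    -- some pair realises `10θ` at `t₁`
    obtain ⟨k₁, hk₁, l₁, hl₁, hkl₁⟩ : ∃ k₁ ∈ G, ∃ l₁ ∈ G, 10 * θ ≤ ‖v k₁ t₁ - v l₁ t₁‖ := by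
      by_contra hno
      push Not at hno
      have hnear : ∀ᶠ s in 𝓝 t₁, ∀ p ∈ G ×ˢ G, ‖v p.1 s - v p.2 s‖ < 10 * θ := by
        rw [Filter.eventually_all_finset]
        intro p hp
        have hp' := Finset.mem_product.mp hp
        exact (((hvc p.1).sub (hvc p.2)).norm).continuousAt.eventually_lt continuousAt_const (hno p.1 hp'.1 p.2 hp'.2)
      obtain ⟨δ, hδ, hball⟩ := Metric.eventually_nhds_iff.mp hnear
      have hcontra : t₁ + δ ≤ t₁ := by
        rw [ht₁]
        refine le_csInf hBADne fun b hb ↦ ?_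
        by_contra hlt
        push Not at hlt
        have hb1 : sInf BAD ≤ b := csInf_le hBADbdd hb
        have hdist : dist b (sInf BAD) < δ := by
          rw [Real.dist_eq, abs_of_nonneg (by linarith)]; linarith
        obtain ⟨k', hk', l', hl', hkl'⟩ := hb.2
        have := hball hdist (k', l') (Finset.mem_product.mpr ⟨hk', hl'⟩)
        exact absurd this (not_lt.mpr hkl'.le)
      linarith
    -- PHASE 1 conclusion (also settles `t ≤ t₁`)
    have hdrift1 : ∀ s ∈ Icc a₀ t₁, ∀ k ∈ G, ‖v k s - v k a₀‖ ≤ 11 * θ + 11 * θg := fun s hs k hk ↦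
      phase1 s ⟨hs.1, hs.2.trans ht₁u⟩ (hsp_le s hs) k hk
    by_cases htt₁ : t ≤ t₁
    · have h1 := hdrift1 t ⟨ht.1, htt₁⟩ k hk
      have hd0 : 0 ≤ (d : ℝ) * θg := by positivity
      rw [Nat.cast_succ]
      linarith only [h1, hd0, hθpos, hθg]
    push Not at htt₁
    -- PHASE 2: split `G` at `t₁` by the empty band of its velocity configuration
    obtain ⟨θ', hθ'lo, hθ'hi, hθ'pos, hdich, htrans⟩ :=
      exists_gap_finset G (fun i ↦ v i t₁) (by positivity : (0 : ℝ) < 10 * θ) (by norm_num : (2 : ℝ) ≤ 400)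
    -- size of the new threshold
    have hθ'le : θ' ≤ θ / 40 := by
      have : 10 * θ / 400 = θ / 40 := by ring
      linarith only [this, hθ'hi]
    rw [hQgen] at hθ'lo
    have hθ'ge : 24 * (N + d) * θg * Q ^ (d ^ 3 + d) ≤ θ' := by
      -- `θ' ≥ 10θ/Q^{|G|²+1} ≥ 10θ/Q^{(d+1)²+1}` and `θ ≥ 24(N+d+1)θg·Q^{(d+1)³+(d+1)} ≥ 24(N+d)θg Q^{d³+d} Q^{(d+1)²+1}`
      set e : ℕ := (d + 1) ^ 2 + 1 with he
      have hQe : 0 < Q ^ e := pow_pos hQ0 e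
      have h1 : 10 * θ / Q ^ e ≤ θ' := by
        refine le_trans ?_ hθ'lo
        refine div_le_div_of_nonneg_left (by positivity) (pow_pos hQ0 _) ?_
        refine pow_le_pow_right₀ hQ1 ?_
        have : G.card * G.card ≤ (d + 1) * (d + 1) := Nat.mul_le_mul hGcard hGcard
        have h' : (d + 1) * (d + 1) = (d + 1) ^ 2 := (sq (d + 1)).symm
        rw [he]; omega
      have hexp : Q ^ (d ^ 3 + d) * Q ^ e ≤ Q ^ ((d + 1) ^ 3 + (d + 1)) := by
        rw [← pow_add]
        exact pow_le_pow_right₀ hQ1 (level_exponent_le d)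
      have hcoef : 24 * ((N : ℝ) + d) * θg ≤ 24 * (N + (d + 1 : ℕ)) * θg := by
        have hd1 : ((d + 1 : ℕ) : ℝ) = (d : ℝ) + 1 := Nat.cast_succ d
        have h' : (N : ℝ) + d ≤ N + (d + 1 : ℕ) := by rw [hd1]; linarith only
        exact mul_le_mul_of_nonneg_right (mul_le_mul_of_nonneg_left h' (by norm_num)) hθg.le
      have hc0 : 0 ≤ 24 * ((N : ℝ) + d) * θg := by positivity
      have h2 : 24 * (N + d) * θg * Q ^ (d ^ 3 + d) * Q ^ e ≤ θ := by
        calc 24 * (N + d) * θg * Q ^ (d ^ 3 + d) * Q ^ e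
            = 24 * (N + d) * θg * (Q ^ (d ^ 3 + d) * Q ^ e) := by rw [mul_assoc]
          _ ≤ 24 * (N + d) * θg * Q ^ ((d + 1) ^ 3 + (d + 1)) := mul_le_mul_of_nonneg_left hexp hc0
          _ ≤ 24 * (N + (d + 1 : ℕ)) * θg * Q ^ ((d + 1) ^ 3 + (d + 1)) :=
              mul_le_mul_of_nonneg_right hcoef (pow_nonneg hQ0.le _)
          _ ≤ θ := hθ
      rw [← le_div_iff₀ hQe] at h2
      have h3 : θ / Q ^ e ≤ 10 * θ / Q ^ e := by
        rw [div_le_div_iff_of_pos_right hQe]; linarith only [hθpos]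
      linarith only [h1, h2, h3]
    have hNθ' : 24 * (N + d) * θg ≤ θ' := by
      have h1 : (1 : ℝ) ≤ Q ^ (d ^ 3 + d) := one_le_pow₀ hQ1
      have h0 : 0 ≤ 24 * ((N : ℝ) + d) * θg := by positivity
      have := mul_le_mul_of_nonneg_left h1 h0
      linarith only [this, hθ'ge]
    -- classes are proper: the realised pair `k₁, l₁` is split
    have hcls_card : ∀ k ∈ G, (G.filter fun l ↦ ‖v k t₁ - v l t₁‖ < θ').card ≤ d := by
      intro k hk
      set C : Finset (Fin N) := G.filter fun l ↦ ‖v k t₁ - v l t₁‖ < θ' with hC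
      have hcls_slow : ∀ k' ∈ C, ∀ l' ∈ C, ‖v k' t₁ - v l' t₁‖ < θ' := by
        intro k' hk' l' hl'
        have h1 := (Finset.mem_filter.mp hk')
        have h2 := (Finset.mem_filter.mp hl')
        have h1' : ‖v k' t₁ - v k t₁‖ < θ' := by rw [norm_sub_rev]; exact h1.2
        exact htrans k' h1.1 k hk l' h2.1 h1' h2.2
      have hout : k₁ ∉ C ∨ l₁ ∉ C := by
        by_contra h
        push Not at h
        have := hcls_slow k₁ h.1 l₁ h.2
        linarith
      have hsub : C ⊆ G := Finset.filter_subset _ _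
      have hss : C ⊂ G := by
        rcases hout with h | h
        · exact Finset.ssubset_iff_subset_ne.mpr ⟨hsub, fun he ↦ h (he ▸ hk₁)⟩
        · exact Finset.ssubset_iff_subset_ne.mpr ⟨hsub, fun he ↦ h (he ▸ hl₁)⟩
      have := Finset.card_lt_card hss
      omega
    haveI : Nonempty (Fin n) := by
      have hpos : 0 < ‖v k₁ t₁ - v l₁ t₁‖ := by nlinarith
      obtain ⟨ℓ₀, -⟩ := exists_abs_apply_eq_norm _ hpos
      exact ⟨ℓ₀⟩
    -- the literal-base form of the level threshold for `crossBootstrap`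
    have hθ'ge' : 24 * (N + d) * θg * 400 ^ (d ^ 3 + d) ≤ θ' := by rw [hQgen]; exact hθ'ge
    -- budget for the split phase
    have hbud' : K * (∫ s in t₁..u, φ s) + mmin * (N ^ 2 * ε₀) ≤ mmin * (10 * θg + (N - d) * (N ^ 2 * ε₀)) := by
      have hmono : ∫ s in t₁..u, φ s ≤ ∫ s in a₀..u, φ s :=
        intervalIntegral.integral_mono_interval hat₁ ht₁u le_rfl (Eventually.of_forall fun x ↦ hφ0 x)
          (hφc.intervalIntegrable _ _)
      have hK1 := mul_le_mul_of_nonneg_left hmono hK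
      have hNd : ((N : ℝ) - (d + 1 : ℕ)) * (N ^ 2 * ε₀) + N ^ 2 * ε₀ = (N - d) * (N ^ 2 * ε₀) := by
        rw [Nat.cast_succ]; ring
      calc K * (∫ s in t₁..u, φ s) + mmin * (N ^ 2 * ε₀)
          ≤ mmin * (10 * θg + (N - (d + 1 : ℕ)) * (N ^ 2 * ε₀)) + mmin * (N ^ 2 * ε₀) := by linarith only [hK1, hbud]
        _ = mmin * (10 * θg + (N - d) * (N ^ 2 * ε₀)) := by rw [← hNd]; ring
    have hdrift2 : ‖v k t - v k t₁‖ ≤ 12 * θ' + 12 * d * θg :=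
      crossBootstrap hK hξ hv hA hfar hθg hε₀ hmmin hE1 IH hTt₁ ht₁u hθ'pos hdich htrans hθ'ge' hcls_card
        hφc hφ0 (fun s hs i hi j hj ↦ hφ s ⟨hat₁.trans hs.1, hs.2⟩ i hi j hj) hbud' k hk t ⟨htt₁.le, ht.2⟩
    -- combine the two phases
    have h1 := hdrift1 t₁ ⟨hat₁, le_rfl⟩ k hk
    calc ‖v k t - v k a₀‖ = ‖(v k t - v k t₁) + (v k t₁ - v k a₀)‖ := by abel_nf
      _ ≤ ‖v k t - v k t₁‖ + ‖v k t₁ - v k a₀‖ := norm_add_le _ _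
      _ ≤ (12 * θ' + 12 * d * θg) + (11 * θ + 11 * θg) := add_le_add hdrift2 h1
      _ ≤ 12 * θ + 12 * (d + 1 : ℕ) * θg := by
          rw [Nat.cast_succ]
          have hd0 : 0 ≤ (d : ℝ) * θg := by positivity
          linarith only [hθ'le, hd0, hθg, hθpos]

/-- Registered helper form of `slowGroup_induction` (Lemma Λ of the clean-scale toy, `p = 3/2`). [folklore] -/
theorem endgame_toy_slowGroup : open Filter Topology in ∀ (N n : ℕ) (m : Fin N → ℝ) (ξ v a : Fin N → ℝ → (Fin n → ℝ)) (t₀ K T A mmin θg ε₀ : ℝ), (∀ i, mmin ≤ m i) → 0 < mmin → 0 ≤ K → (∀ i t, HasDerivAt (ξ i) (v i t) t) → (∀ i t, HasDerivAt (v i) (a i t) t) → (∀ (C : Finset (Fin N)) (t r : ℝ), t₀ ≤ t → 0 < r → r ≤ t → C.Nonempty → (∀ i ∈ C, ∀ j ∉ C, r ≤ ‖ξ i t - ξ j t‖) → ‖∑ i ∈ C, m i • a i t‖ ≤ K * r ^ (-(3 / 2 : ℝ))) → t₀ ≤ T → 1 ≤ T → 0 < A → (∀ i j, i ≠ j → ∀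 t, T ≤ t → A ≤ ‖ξ i t - ξ j t‖) → 0 < θg → 0 ≤ ε₀ → 100 * (N : ℝ) ^ 3 * ε₀ ≤ θg → K * (2 * √2 * (8 / (θg * √A))) ≤ mmin * ε₀ → K * (2 * (√T)⁻¹) ≤ mmin * ε₀ → ∀ (d : ℕ) (G : Finset (Fin N)), G.card ≤ d → G.Nonempty → ∀ (a₀ u θ : ℝ) (φ : ℝ → ℝ), T ≤ a₀ → a₀ ≤ u → 24 * (N + d) * θg * 400 ^ (d ^ 3 + d) ≤ θ → (∀ k ∈ G, ∀ l ∈ G, ‖v k a₀ - v l a₀‖ ≤ θ) → Continuous φ → (∀ s, 0 ≤ φ s) → (∀ s ∈ Set.Icc a₀ u, ∀ i ∈ G, ∀ j ∉ G, (‖ξ i s - ξ j s‖ * √‖ξ i s - ξ j s‖)⁻¹ ≤ φ s) → K * (∫ s in a₀..u, φ s) ≤ mmin * (10 * θg + (N - d) * (N ^ 2 * ε₀)) → ∀ t ∈ Set.Icc a₀ u, ∀ k ∈ G, ‖v k t - v k a₀‖ ≤ 12 * θ + 12 * d * θg :=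
  fun _ _ _ _ _ _ _ _ _ _ _ _ _ hm hmmin hK hξ hv hbal hT hT1 hA hfar hθg hε₀ hεθ hE1 hE2 ↦
    slowGroup_induction hm hmmin hK hξ hv hbal hT hT1 hA hfar hθg hε₀ hεθ hE1 hE2

end Summit.FinalStateConjecture.FinalStateConjecture.Theorems.SublinearIsFree.Toy

end
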